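import Summits.FinalStateConjecture.FinalStateConjecture.Theorems.EIHFluxBalanceInertialRecessionStubRechart3CentrePath
import Summits.FinalStateConjecture.FinalStateConjecture.Theorems.EIHFluxBalanceInertialRecessionStubRechartClock

/-!
# Route EIHFluxBalance — `InertialRecession`, re-charting: the clock map and the honest chart

Helper file for the crux `stmt-FinalStateConjecture-10166`
(`Summit.FinalStateConjecture.FinalStateConjecture.Theses.EIHFluxBalance.InertialRecession`),
line `sublinear-is-free-clean-window-charges`, stub `stub_rechart` (the transfer P2), part G1.

The honest (comoving) chart of a hole with normalised frame `Λ̃(t)`, painted centre `ξ(t)` and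
proper-time clock `T₀` (`dT₀/dτ = ũ⁰(T₀)`, `…StubRechartClock`) maps rest coordinates
`y = (τ, ỹ) ∈ E4` to lab coordinates:
* `clockMap Λ̃ T₀ y = T₀(τ) + frameTilt (Λ̃ (T₀ τ)) ỹ` — the lab time of the chart point;
* `honestChart Λ̃ ξ T₀ y = c(T) + purgedFrame (Λ̃ T) ỹ`, `T = clockMap Λ̃ T₀ y`, `c(t) = (t, ξ t)`.
This file records: the lab time of the chart point IS `T` (`honestChart_apply_zero`); the exact
painted-radius and own-summand identities (`radius_poincareInv_honestChart`,
`boostedKerrBilin_honestChart_apply`, from `…StubRechartCentre`: the painted rest position of the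
chart point relative to the frame `Λ̃ T` centred at `c T` is the purged vector, whose spatial part is
`ỹ`); smoothness; the differentials (`hasFDerivAt_clockMap`, `hasFDerivAt_honestChart`); and the
**centre-point identity** `Dψ(τ, 0) v − Λ̃(T₀ τ) v = DT(τ,0) v • (c'(T₀ τ) − ũ/ũ⁰)`
(`fderiv_honestChart_centre_sub`), by which `Dψ` differs from the frame at the centre only through
the slaved velocity mismatch. [folklore]
-/

noncomputable section

set_option linter.dupNamespace false

open Set Filter Function Metric Topology
open scoped ContDiff
open Literature.Geometry.Lorentzian

namespace Summit.FinalStateConjecture.FinalStateConjecture.Theorems.SublinearIsFree.Rechart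

/-! ### Definitions -/

/-- **The clock map** `T(τ, ỹ) = T₀(τ) + frameTilt (Λ (T₀ τ)) ỹ`: the lab time of the honest chart
point with rest coordinates `(τ, ỹ)`. [folklore] -/
def clockMap (Λ : ℝ → lorentzGroup) (T₀ : ℝ → ℝ) (y : E4) : ℝ :=
  T₀ (y 0) + frameTilt (Λ (T₀ (y 0))) (E4.spatial y)

/-- **The honest chart** `ψ(y) = c(T y) + purgedFrame (Λ (T y)) ỹ`. [folklore] -/
def honestChart (Λ : ℝ → lorentzGroup) (ξ : ℝ → E3) (T₀ : ℝ → ℝ) (y : E4) : E4 :=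
  centrePath ξ (clockMap Λ T₀ y) + purgedFrame (Λ (clockMap Λ T₀ y)) (E4.spatial y)

section Values

variable (Λ : ℝ → lorentzGroup) (ξ : ℝ → E3) (T₀ : ℝ → ℝ)

/-- On the centre line (`ỹ = 0`) the clock map is the clock. [folklore] -/
theorem clockMap_of_spatial_eq_zero {y : E4} (hy : E4.spatial y = 0) :
    clockMap Λ T₀ y = T₀ (y 0) := by
  rw [clockMap, hy, map_zero, add_zero]

/-- **The lab time of the chart point is the clock map.** [folklore] -/
theorem honestChart_apply_zero (y : E4) : honestChart Λ ξ T₀ y 0 = clockMap Λ T₀ y := by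
  rw [honestChart, PiLp.add_apply, purgedFrame_apply_zero, add_zero, centrePath,
    E4.ofTimeSpace_apply_zero]

/-- The lab position of the chart point. [folklore] -/
theorem spatial_honestChart (y : E4) : E4.spatial (honestChart Λ ξ T₀ y) =
    ξ (clockMap Λ T₀ y) + E4.spatial (purgedFrame (Λ (clockMap Λ T₀ y)) (E4.spatial y)) := by
  rw [honestChart, map_add, centrePath, E4.spatial_ofTimeSpace]

/-- The chart point in the form of `…StubRechartCentre`: centre plus frame applied to the purged
vector. [folklore] -/
theorem honestChart_eq_chartPoint (y : E4) :
    honestChart Λ ξ T₀ y = E4.ofTimeSpace (clockMap Λ T₀ y) (ξ (clockMap Λ T₀ y)) +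
      (Λ (clockMap Λ T₀ y) : E4 ≃L[ℝ] E4) (E4.ofTimeSpace 0 (E4.spatial y) -
        ((((Λ (clockMap Λ T₀ y) : E4 ≃L[ℝ] E4) (E4.ofTimeSpace 0 (E4.spatial y))) 0) /
          (((Λ (clockMap Λ T₀ y) : E4 ≃L[ℝ] E4) (E4.basisVector 0)) 0)) • E4.basisVector 0) := by
  rw [honestChart, centrePath, purgedFrame_eq_apply_purge]

/-- **Exact painted-radius identity**: the painted Kerr–Schild radius of the chart point, relative
to the frame `Λ (T y)` centred at `c (T y)`, is the chart radius `r_a(y)`. [folklore] -/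
theorem radius_poincareInv_honestChart (a : ℝ) (y : E4) :
    Kerr.radius a (poincareInv (Λ (clockMap Λ T₀ y))
      (E4.ofTimeSpace (clockMap Λ T₀ y) (ξ (clockMap Λ T₀ y))) (honestChart Λ ξ T₀ y)) =
      Kerr.radius a y :=
  radius_poincareInv_chartPoint (Λ (clockMap Λ T₀ y)) (clockMap Λ T₀ y) (ξ (clockMap Λ T₀ y)) y rfl
    (honestChart_eq_chartPoint Λ ξ T₀ y) a

/-- **Exact own-summand identity**: the painted boosted Kerr–Schild form of the frame `Λ (T y)`
centred at `c (T y)`, at the chart point, is the rest-frame form at `y` in the frame. [folklore] -/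
theorem boostedKerrBilin_honestChart_apply (M a : ℝ) (y v v' : E4) :
    boostedKerrBilin (Λ (clockMap Λ T₀ y)) (E4.ofTimeSpace (clockMap Λ T₀ y) (ξ (clockMap Λ T₀ y)))
      M a (honestChart Λ ξ T₀ y) v v' =
      Kerr.bilin M a y ((Λ (clockMap Λ T₀ y) : E4 ≃L[ℝ] E4).symm v)
        ((Λ (clockMap Λ T₀ y) : E4 ≃L[ℝ] E4).symm v') :=
  boostedKerrBilin_chartPoint_apply (Λ (clockMap Λ T₀ y)) (clockMap Λ T₀ y) (ξ (clockMap Λ T₀ y)) y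
    rfl (honestChart_eq_chartPoint Λ ξ T₀ y) M a v v'

end Values

/-! ### Smoothness and differentials -/

section Calculus

variable (Λ : ℝ → lorentzGroup) (ξ : ℝ → E3) (T₀ : ℝ → ℝ)
  (hΛ : ContDiff ℝ ∞ (fun t ↦ ((Λ t : E4 ≃L[ℝ] E4) : E4 →L[ℝ] E4)))
  (hξ : ContDiff ℝ ∞ ξ) (hT₀ : ContDiff ℝ ∞ T₀)

/-- The time coordinate is a smooth (linear) function. [folklore] -/
theorem contDiff_apply_zero {n : WithTop ℕ∞} : ContDiff ℝ n fun y : E4 ↦ y 0 :=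
  (EuclideanSpace.proj (0 : Fin 4) : E4 →L[ℝ] ℝ).contDiff

include hΛ hT₀ in
/-- The clock map is smooth. [folklore] -/
theorem contDiff_clockMap : ContDiff ℝ ∞ (clockMap Λ T₀) := by
  have h1 : ContDiff ℝ ∞ fun y : E4 ↦ T₀ (y 0) := hT₀.comp contDiff_apply_zero
  have h2 : ContDiff ℝ ∞ fun y : E4 ↦ frameTilt (Λ (T₀ (y 0))) :=
    (contDiff_frameTilt Λ hΛ).comp h1
  exact h1.add (h2.clm_apply E4.spatial.contDiff)

include hΛ hξ hT₀ in
/-- The honest chart is smooth. [folklore] -/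
theorem contDiff_honestChart : ContDiff ℝ ∞ (honestChart Λ ξ T₀) := by
  have hT := contDiff_clockMap Λ T₀ hΛ hT₀
  have h1 : ContDiff ℝ ∞ fun y ↦ centrePath ξ (clockMap Λ T₀ y) := (contDiff_centrePath hξ).comp hT
  have h2 : ContDiff ℝ ∞ fun y ↦ purgedFrame (Λ (clockMap Λ T₀ y)) :=
    (contDiff_purgedFrame Λ hΛ).comp hT
  exact h1.add (h2.clm_apply E4.spatial.contDiff)

include hΛ hT₀ in
/-- **The differential of the clock map**:
`DT(y) v = T₀'(y⁰) (1 + (frameTilt ∘ Λ)'(T₀ y⁰) ỹ) v⁰ + frameTilt (Λ (T₀ y⁰)) ṽ`. [folklore] -/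
theorem hasFDerivAt_clockMap (y : E4) :
    HasFDerivAt (clockMap Λ T₀)
      ((deriv T₀ (y 0) * (1 + deriv (fun t ↦ frameTilt (Λ t)) (T₀ (y 0)) (E4.spatial y))) •
          (EuclideanSpace.proj (0 : Fin 4) : E4 →L[ℝ] ℝ) +
        (frameTilt (Λ (T₀ (y 0)))).comp E4.spatial) y := by
  set L : ℝ → E3 →L[ℝ] ℝ := fun t ↦ frameTilt (Λ t) with hL
  have hLd : Differentiable ℝ L := (contDiff_frameTilt Λ hΛ).differentiable (by simp)
  have hT₀d : Differentiable ℝ T₀ := hT₀.differentiable (by simp)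
  have hp : HasFDerivAt (fun y : E4 ↦ y 0) (EuclideanSpace.proj (0 : Fin 4) : E4 →L[ℝ] ℝ) y :=
    (EuclideanSpace.proj (0 : Fin 4) : E4 →L[ℝ] ℝ).hasFDerivAt
  -- `y ↦ T₀ (y 0)`
  have hA : HasFDerivAt (fun y : E4 ↦ T₀ (y 0))
      ((EuclideanSpace.proj (0 : Fin 4) : E4 →L[ℝ] ℝ).smulRight (deriv T₀ (y 0))) y :=
    hasFDerivAt_comp_scalar (hT₀d (y 0)).hasDerivAt hp
  -- `y ↦ L (T₀ (y 0))`
  have hB : HasFDerivAt (fun y : E4 ↦ L (T₀ (y 0)))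
      (((EuclideanSpace.proj (0 : Fin 4) : E4 →L[ℝ] ℝ).smulRight (deriv T₀ (y 0))).smulRight
        (deriv L (T₀ (y 0)))) y :=
    hasFDerivAt_comp_scalar (hLd (T₀ (y 0))).hasDerivAt hA
  -- `y ↦ L (T₀ (y 0)) ỹ`
  have hC := hB.clm_apply E4.spatial.hasFDerivAt
  have hD := hA.add hC
  have hfun : clockMap Λ T₀ = fun y ↦ T₀ (y 0) + L (T₀ (y 0)) (E4.spatial y) := rfl
  rw [hfun]
  refine hD.congr_fderiv (ContinuousLinearMap.ext fun v ↦ ?_)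
  simp only [add_apply, FunLike.coe_smul, Pi.smul_apply,
    ContinuousLinearMap.coe_comp, comp_apply, ContinuousLinearMap.smulRight_apply,
    ContinuousLinearMap.flip_apply, smul_eq_mul, hL, PiLp.proj_apply]
  ring

include hΛ hξ in
/-- **The differential of the honest chart**:
`Dψ(y) v = DT(y) v • (c'(T y) + (purgedFrame ∘ Λ)'(T y) ỹ) + purgedFrame (Λ (T y)) ṽ`. [folklore] -/
theorem hasFDerivAt_honestChart (y : E4) {D : E4 →L[ℝ] ℝ} (hD : HasFDerivAt (clockMap Λ T₀) D y) :
    HasFDerivAt (honestChart Λ ξ T₀)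
      (D.smulRight (deriv (centrePath ξ) (clockMap Λ T₀ y) +
          deriv (fun t ↦ purgedFrame (Λ t)) (clockMap Λ T₀ y) (E4.spatial y)) +
        (purgedFrame (Λ (clockMap Λ T₀ y))).comp E4.spatial) y := by
  set P : ℝ → E3 →L[ℝ] E4 := fun t ↦ purgedFrame (Λ t) with hP
  have hPd : Differentiable ℝ P := (contDiff_purgedFrame Λ hΛ).differentiable (by simp)
  have hcd : Differentiable ℝ (centrePath ξ) := (contDiff_centrePath hξ).differentiable (by simp)
  have h1 : HasFDerivAt (fun y ↦ centrePath ξ (clockMap Λ T₀ y))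
      (D.smulRight (deriv (centrePath ξ) (clockMap Λ T₀ y))) y :=
    hasFDerivAt_comp_scalar (hcd _).hasDerivAt hD
  have h2 : HasFDerivAt (fun y ↦ P (clockMap Λ T₀ y)) (D.smulRight (deriv P (clockMap Λ T₀ y))) y :=
    hasFDerivAt_comp_scalar (hPd _).hasDerivAt hD
  have h3 := h2.clm_apply E4.spatial.hasFDerivAt
  have h4 := h1.add h3
  have hfun : honestChart Λ ξ T₀ = fun y ↦ centrePath ξ (clockMap Λ T₀ y) +
      P (clockMap Λ T₀ y) (E4.spatial y) := rfl
  rw [hfun]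
  refine h4.congr_fderiv (ContinuousLinearMap.ext fun v ↦ ?_)
  simp only [add_apply, ContinuousLinearMap.coe_comp, comp_apply,
    ContinuousLinearMap.smulRight_apply, ContinuousLinearMap.flip_apply, hP, smul_add,
    FunLike.coe_smul, Pi.smul_apply]
  abel

include hΛ hT₀ in
/-- The differential of the clock map at a point of the centre line `ỹ = 0`. [folklore] -/
theorem hasFDerivAt_clockMap_centre {y : E4} (hy : E4.spatial y = 0) :
    HasFDerivAt (clockMap Λ T₀)
      ((deriv T₀ (y 0)) • (EuclideanSpace.proj (0 : Fin 4) : E4 →L[ℝ] ℝ) +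
        (frameTilt (Λ (T₀ (y 0)))).comp E4.spatial) y := by
  have h := hasFDerivAt_clockMap Λ T₀ hΛ hT₀ y
  rwa [hy, map_zero, add_zero, mul_one] at h

include hΛ hξ hT₀ in
/-- **The centre-point identity.** On the centre line (`ỹ = 0`), if the clock runs at the painted
Lorentz factor there (`T₀'(y⁰) = ũ⁰(T₀ y⁰)`), the differential of the honest chart differs from the
frame only through the velocity mismatch:
`Dψ(y) v − Λ(T₀ y⁰) v = DT(y) v • (c'(T₀ y⁰) − ũ/ũ⁰)`. [folklore] -/
theorem fderiv_honestChart_centre_sub {y : E4} (hy : E4.spatial y = 0)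
    (hclock : deriv T₀ (y 0) = frameVel (Λ (T₀ (y 0))) 0) (v : E4) :
    fderiv ℝ (honestChart Λ ξ T₀) y v - (Λ (T₀ (y 0)) : E4 ≃L[ℝ] E4) v =
      ((deriv T₀ (y 0)) * v 0 + frameTilt (Λ (T₀ (y 0))) (E4.spatial v)) •
        (deriv (centrePath ξ) (T₀ (y 0)) - normVel (Λ (T₀ (y 0)))) := by
  have hD := hasFDerivAt_clockMap_centre Λ T₀ hΛ hT₀ hy
  have hψ := hasFDerivAt_honestChart Λ ξ T₀ hΛ hξ y hD
  rw [hψ.fderiv, clockMap_of_spatial_eq_zero Λ T₀ hy, hy, map_zero, add_zero]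
  rw [← frozen_differential (Λ (T₀ (y 0))) v, ← hclock]
  simp only [add_apply, ContinuousLinearMap.coe_comp, comp_apply,
    ContinuousLinearMap.smulRight_apply, FunLike.coe_smul, Pi.smul_apply, smul_eq_mul,
    PiLp.proj_apply, smul_sub]
  abel

end Calculus

/-- Registered one-line form (worker carrier `rechart_honestChart_apply_zero`) of
`honestChart_apply_zero`, with `clockMap`, `purgedFrame`, `frameTilt`, `normVel` unfolded: the lab
time of the honest chart point is the clock map. [folklore] -/
theorem rechart_honestChart_apply_zero : open Literature.Geometry.Lorentzian in ∀ (Λ : ℝ → lorentzGroup) (ξ : ℝ → E3) (T₀ : ℝ → ℝ) (y : E4), let T : ℝ := T₀ (y 0) + ((Λ (T₀ (y 0)) : E4 ≃L[ℝ] E4) (E4.ofTimeSpace 0 (E4.spatial y))) 0; (E4.ofTimeSpace T (ξ T) + ((Λ T : E4 ≃L[ℝ] E4) (E4.ofTimeSpace 0 (E4.spatial y)) - (((Λ T : E4 ≃L[ℝ] E4) (E4.ofTimeSpace 0 (E4.spatial y))) 0) • ((((Λ T : E4 ≃L[ℝ] E4) (E4.basisVector 0)) 0)⁻¹ • (Λ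 T : E4 ≃L[ℝ] E4) (E4.basisVector 0)))) 0 = T :=
  fun Λ ξ T₀ y ↦ honestChart_apply_zero Λ ξ T₀ y

end Summit.FinalStateConjecture.FinalStateConjecture.Theorems.SublinearIsFree.Rechart

end
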